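import Mathlib.NumberTheory.Real.Irrational
import Literature.Computability.QuantumComplexity.ForrelationCompleteProofs
import Literature.Computability.QuantumComplexity.ReversibleCliffordT
import HarnessLib

/-!
# Aaronson–Ambainis Theorem 25, amplitude form: `Φ_{f₁,…,f_k} = A_Q` (proved, with the parity repair)

Topic `Literature/Computability/QuantumComplexity`; sibling of `ForrelationCompleteProofs.lean`
(gate set `{H, CCSIGN}` = `hCCSign`, transition amplitude `A_Q = transitionAmplitude Q`, the
Fig. 2 circuit `forrelationCircuit` with `forrelationCircuit_apply_zero_zero : ⟨0|·|0⟩ = Φ`, the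
two-qubit Hadamard gadget `hadamard_gadget_qReg`). Source: S. Aaronson, A. Ambainis,
*Forrelation*, SIAM J. Comput. 47 (2018) = arXiv:1411.5729, §6, proof of Thm. 25 (pp. 26–27 of
the arXiv version).

## What is proved

The linear-algebraic heart of the reduction QSIM `≤ₚ` FORRELATION (AA Thm. 25): for every
`n`-qubit circuit `Q` over `{H, CCSIGN}` with `m` gates there are Boolean functions
`f₁, …, f_k`, each constant or the product of `2` or `3` input bits (`IsFewBitProduct`), with
`Φ_{f₁,…,f_k} = A_Q` **exactly** (`AaronsonAmbainis2018_thm25_amplitude_corrected`), where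

* `k ≤ 4(m + n + 1) + 2` and the `fᵢ` live on `N ≤ n + 2` bits;
* `N = n + 1` and `k = 4m + 1` whenever the number `h` of Hadamard gates of `Q` is even
  (`kForrelationValue_forrBuild_of_even`, the printed bookkeeping verbatim);
* `N = n + 1` whenever `n` is even (`h` odd: pad `Q` with one Hadamard per wire and one bare
  `H^{⊗N}` layer, `kForrelationValue_forrBuildPadded`);
* and `N = n + 2` is NECESSARY in the remaining case: for `n = 1` and `Q = H` (so `A_Q = 1/√2`)
  no family of Boolean functions on `n + 1 = 2` bits has `Φ = A_Q`, because every Forrelation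
  value on an even number of bits is a dyadic rational (`kForrelationValue_two_mul_eq_div`,
  `not_exists_kForrelationValue_eq_hadamard`).

The last point corrects the printed claim "`f₁,…,f_k : {0,1}^{n+1} → {-1,1}`" (p. 27): the
printed bookkeeping pairs every unpaired Hadamard gate with the dummy qubit, which is thereby
Hadamarded once per use and ends in `H|0⟩` rather than `|0⟩` when `h` is odd; the theorem
(`PromiseBQP`-hardness, a polynomial-time reduction) is unaffected, only the bit count `n + 1`
and `k = O(m)` become `n + 2` and `k = O(m + n)`.

## Proof architecture (all PROVED)

* `forrelationCircuitL`: the Fig. 2 circuit of a *list* of functions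
  (`forrelationCircuit k f = forrelationCircuitL (List.ofFn f)`), and the **composition law**
  `forrelationCircuitL (f ++ 1 :: g) = forrelationCircuitL g * forrelationCircuitL f`
  (a constant function cancels the two Hadamard layers around it, AA p. 26), with the blocks
  `[1] ↦ I`, `[1, g, 1] ↦ U_g` (a CCSIGN gate), `[g, g, g] ↦ H U_g H U_g H U_g H` (the gadget).
* `hGateAll_eq_placeGate_mul_placeGate`: `H^{⊗N} = (H^{⊗k} on the wires of e) · (H^{⊗(N-k)} on
  the other wires)` for every wire embedding `e`, whence the **gadget on `N` wires**
  (`gadget_eq_placeGate`): with `C` the CSIGN phase on wires `p ≠ d`,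
  `H^{⊗N} C H^{⊗N} C H^{⊗N} C H^{⊗N} = (SWAP · H^{⊗2})_{p,d} ⊗ I` (from `hadamard_gadget_qReg`).
* `forrBuild`/`forrBuild_spec`: the gate-by-gate translation with the wire bookkeeping as an explicit
  bijection `σ : Fin N ≃ Option (Fin n)` (physical wire ↦ logical wire or dummy), and the
  **entrywise invariant**
  `⟨x| F |y⟩ = ⟨read_σ' x| Q |read_σ y⟩ · ⟨x_{dummy'}| H^h |y_{dummy}⟩`
  (`σ'` the final bookkeeping, `h` the number of Hadamard gates) — no permutation matrices.
* parity repair (`forrBuildPadded`, `toMatrix_hOnAllWires : ∏ₐ H_a = H^{⊗n}`), lifting to an idle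
  wire (`liftCircuitSucc`, `toMatrix_liftCircuitSucc`), dyadic obstruction (`irrational_sqrt_two`).

## References

* S. Aaronson, A. Ambainis, *Forrelation: a problem that optimally separates quantum from
  classical computing*, SIAM J. Comput. 47 (2018) 982–1038; arXiv:1411.5729, §6, Thm. 25 and
  its proof (pp. 26–27), Thm. 26 (p. 28).
* M. A. Nielsen, I. L. Chuang, *Quantum Computation and Quantum Information*, CUP 2010, §1.4.4
  eq. (1.50) (`H^{⊗n}`), §4.2 (placement of gates).
-/

noncomputable section

namespace Literature.Computability.QuantumComplexity

open Matrix _root_.Computability Complexity Cryptography Finset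

variable {N n k : ℕ}

/-! ### Sums over registers agreeing off a set of wires; products with placed gates -/

/-- Overwriting the wires `e` of a register `v` with `z` and restricting back to `e` gives `z`.
[folklore] -/
theorem extend_comp_embedding (e : Fin k ↪ Fin N) (z : QReg k) (v : QReg N) :
    (Function.extend e z v) ∘ e = z :=
  funext fun j => e.injective.extend_apply _ _ j

/-- Off the wires of `e`, overwriting along `e` does nothing. [folklore] -/
theorem extend_apply_of_not_mem (e : Fin k ↪ Fin N) (z : QReg k) (v : QReg N) {i : Fin N}
    (hi : i ∉ Set.range e) : Function.extend e z v i = v i :=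
  Function.extend_apply' _ _ _ (by rintro ⟨j, rfl⟩; exact hi ⟨j, rfl⟩)

/-- **Sums over registers agreeing with `v` off the wires of `e`** are sums over the contents of
those wires: `∑_{w : w = v off e} Φ(w) = ∑_{z ∈ {0,1}^k} Φ(v with e ↦ z)`. [folklore] -/
theorem sum_ite_agree_eq_sum_extend {M : Type*} [AddCommMonoid M] (e : Fin k ↪ Fin N)
    (v : QReg N) (Φ : QReg N → M) :
    (∑ w : QReg N, if (∀ i, i ∉ Set.range e → w i = v i) then Φ w else 0) =
      ∑ z : QReg k, Φ (Function.extend e z v) := by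
  classical
  let E : QReg k ↪ QReg N :=
    ⟨fun z => Function.extend e z v, fun z z' h => by
      have := congrArg (· ∘ e) h
      simpa only [extend_comp_embedding] using this⟩
  have hfilter : (Finset.univ.filter fun w : QReg N => ∀ i, i ∉ Set.range e → w i = v i) =
      Finset.univ.map E := by
    ext w
    simp only [Finset.mem_filter, Finset.mem_univ, true_and, Finset.mem_map]
    constructor
    · intro hw
      refine ⟨w ∘ e, funext fun i => ?_⟩
      by_cases hi : i ∈ Set.range e
      · obtain ⟨j, rfl⟩ := hi
        exact e.injective.extend_apply _ _ _
      · change Function.extend e (w ∘ e) v i = w i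
        rw [extend_apply_of_not_mem e _ _ hi, hw i hi]
    · rintro ⟨z, rfl⟩ i hi
      exact extend_apply_of_not_mem e z v hi
  rw [← Finset.sum_filter, hfilter, Finset.sum_map]
  rfl

/-- **Right multiplication by a placed gate, entrywise**:
`(M · U_e)(x, y) = ∑_z M(x, y with e ↦ z) · U(z, y|_e)`. [cite: NielsenChuang2010, §4.2] -/
theorem mul_placeGate_apply (M : Matrix (QReg N) (QReg N) ℂ) (e : Fin k ↪ Fin N)
    (U : Matrix (QReg k) (QReg k) ℂ) (x y : QReg N) :
    (M * placeGate e U) x y = ∑ z : QReg k, M x (Function.extend e z y) * U z (y ∘ e) := by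
  rw [Matrix.mul_apply]
  have h : ∀ w, M x w * placeGate e U w y =
      if (∀ i, i ∉ Set.range e → w i = y i) then M x w * U (w ∘ e) (y ∘ e) else 0 := by
    intro w
    rw [placeGate_apply]
    split_ifs <;> simp
  simp_rw [h]
  rw [sum_ite_agree_eq_sum_extend]
  simp_rw [extend_comp_embedding]

/-- **Left multiplication by a placed gate, entrywise**:
`(U_e · M)(x, y) = ∑_z U(x|_e, z) · M(x with e ↦ z, y)`. [cite: NielsenChuang2010, §4.2] -/
theorem placeGate_mul_apply (e : Fin k ↪ Fin N) (U : Matrix (QReg k) (QReg k) ℂ)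
    (M : Matrix (QReg N) (QReg N) ℂ) (x y : QReg N) :
    (placeGate e U * M) x y = ∑ z : QReg k, U (x ∘ e) z * M (Function.extend e z x) y := by
  rw [Matrix.mul_apply]
  have h : ∀ w, placeGate e U x w * M w y =
      if (∀ i, i ∉ Set.range e → w i = x i) then U (x ∘ e) (w ∘ e) * M w y else 0 := by
    intro w
    rw [placeGate_apply]
    by_cases hw : ∀ i, i ∉ Set.range e → x i = w i
    · rw [if_pos hw, if_pos fun i hi => (hw i hi).symm]
    · rw [if_neg hw, if_neg fun h' => hw fun i hi => (h' i hi).symm, zero_mul]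
  simp_rw [h]
  rw [sum_ite_agree_eq_sum_extend]
  simp_rw [extend_comp_embedding]

/-- **Placing a diagonal gate gives a diagonal operator**: `(diag v)_e = diag (x ↦ v(x|_e))`.
[cite: NielsenChuang2010, §4.2] -/
theorem placeGate_diagonal (e : Fin k ↪ Fin N) (v : QReg k → ℂ) :
    placeGate e (Matrix.diagonal v) = Matrix.diagonal fun x => v (x ∘ e) := by
  ext x y
  rw [placeGate_apply]
  by_cases hxy : x = y
  · subst hxy
    simp
  · rw [Matrix.diagonal_apply_ne _ hxy]
    split_ifs with h
    · rw [Matrix.diagonal_apply_ne]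
      intro heq
      refine hxy (funext fun i => ?_)
      by_cases hi : i ∈ Set.range e
      · obtain ⟨j, rfl⟩ := hi
        exact congrFun heq j
      · exact h i hi
    · rfl

/-- **Iterated placement**: placing on the wires `e` of a register that is itself placed on the
wires `f` is placing on the wires `f ∘ e`. [cite: NielsenChuang2010, §4.2] -/
theorem placeGate_placeGate {m : ℕ} (f : Fin N ↪ Fin m) (e : Fin k ↪ Fin N)
    (U : Matrix (QReg k) (QReg k) ℂ) :
    placeGate f (placeGate e U) = placeGate (e.trans f) U := by
  ext x y
  simp only [placeGate_apply]
  by_cases h : ∀ i, i ∉ Set.range (e.trans f) → x i = y i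
  · rw [if_pos h, if_pos, if_pos]
    · rfl
    · intro j hj
      exact h (f j) fun ⟨l, hl⟩ => hj ⟨l, f.injective (by simpa using hl)⟩
    · intro i hi
      exact h i fun ⟨l, hl⟩ => hi ⟨e l, by simpa using hl⟩
  · rw [if_neg h]
    push Not at h
    obtain ⟨i, hi, hne⟩ := h
    by_cases h1 : ∀ i, i ∉ Set.range f → x i = y i
    · rw [if_pos h1, if_neg]
      intro h2
      obtain ⟨j, rfl⟩ : i ∈ Set.range f := by
        by_contra hh
        exact hne (h1 i hh)
      exact hne (h2 j fun ⟨l, hl⟩ => hi ⟨l, by simp [hl]⟩)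
    · rw [if_neg h1]

/-! ### Hadamard entries -/

/-- The entries of the Hadamard gate as a function of two bits: `⟨a|H|b⟩ = (-1)^{ab}/√2`.
[cite: NielsenChuang2010, §1.3.1] -/
def hadamardEntry (a b : Bool) : ℂ :=
  (Real.sqrt 2 : ℂ)⁻¹ * (if (a && b) = true then -1 else 1)

/-- `H^{⊗N}` entrywise as a product over the wires: `⟨x|H^{⊗N}|y⟩ = ∏ᵢ ⟨xᵢ|H|yᵢ⟩`.
[cite: NielsenChuang2010, §1.4.4 eq. (1.50)] -/
theorem hGateAll_apply_eq_prod (x y : QReg N) : hGateAll N x y = ∏ i, hadamardEntry (x i) (y i) := by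
  rw [hGateAll_apply_eq_twist, twist]
  unfold hadamardEntry
  rw [Finset.prod_mul_distrib, Finset.prod_const, Finset.card_univ, Fintype.card_fin]
  push_cast
  congr 1
  refine Finset.prod_congr rfl fun i _ => ?_
  split_ifs <;> simp

/-- The library's Hadamard gate entrywise: `hGate a b = ⟨a₀|H|b₀⟩`. [cite: NielsenChuang2010, §1.3.1] -/
theorem hGate_apply_eq_hadamardEntry (a b : QReg 1) : hGate a b = hadamardEntry (a 0) (b 0) := by
  unfold hGate hadamardEntry
  rw [Matrix.of_apply]
  cases a 0 <;> cases b 0 <;> simp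

/-- `(1/√2)·(1/√2) = 1/2` in `ℂ`. [folklore] -/
theorem inv_sqrt_two_mul_inv_sqrt_two : (Real.sqrt 2 : ℂ)⁻¹ * (Real.sqrt 2 : ℂ)⁻¹ = 1 / 2 := by
  rw [← mul_inv, ← sq, sqrt_two_sq_complex, one_div]

/-- **Orthogonality of the Hadamard rows**: `∑_b ⟨a|H|b⟩⟨b|H|c⟩ = [a = c]` (`H² = I`).
[cite: NielsenChuang2010, §1.3.1 (p. 19, after eq. (1.14): H² = I)] -/
theorem sum_hadamardEntry_mul_hadamardEntry (a c : Bool) :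
    ∑ b, hadamardEntry a b * hadamardEntry b c = if a = c then 1 else 0 := by
  rw [Fintype.sum_bool]
  have h2 := inv_sqrt_two_mul_inv_sqrt_two
  cases a <;> cases c <;> simp [hadamardEntry] <;> linear_combination (2 : ℂ) * h2

/-- The `⟨a| H^m |b⟩` entries of the powers of the Hadamard gate (the dummy qubit's factor after
`m` uses of the gadget): `H⁰ = I`, `H^{m+1} = H^m H`. [cite: AaronsonAmbainis2018, §6 (proof of Thm. 25)] -/
def hadamardPow : ℕ → Bool → Bool → ℂ
  | 0, a, b => if a = b then 1 else 0
  | m + 1, a, b => ∑ c, hadamardPow m a c * hadamardEntry c b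

/-- `H^{m+2} = H^m` entrywise. [cite: NielsenChuang2010, §1.3.1 (H² = I)] -/
theorem hadamardPow_add_two (m : ℕ) (a b : Bool) : hadamardPow (m + 2) a b = hadamardPow m a b := by
  change ∑ c, (∑ c', hadamardPow m a c' * hadamardEntry c' c) * hadamardEntry c b = hadamardPow m a b
  calc ∑ c, (∑ c', hadamardPow m a c' * hadamardEntry c' c) * hadamardEntry c b
      = ∑ c', hadamardPow m a c' * ∑ c, hadamardEntry c' c * hadamardEntry c b := by
        simp_rw [Finset.sum_mul, Finset.mul_sum, mul_assoc]
        exact Finset.sum_comm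
    _ = hadamardPow m a b := by
        simp_rw [sum_hadamardEntry_mul_hadamardEntry]
        simp

/-- Even powers of `H` are the identity: `⟨a|H^{2j}|b⟩ = [a = b]`. [cite: NielsenChuang2010, §1.3.1 (H² = I)] -/
theorem hadamardPow_of_even {m : ℕ} (hm : Even m) (a b : Bool) : hadamardPow m a b = if a = b then 1 else 0 := by
  obtain ⟨j, rfl⟩ := hm
  induction j with
  | zero => rfl
  | succ j ih => rw [show j + 1 + (j + 1) = j + j + 2 by ring, hadamardPow_add_two, ih]

/-! ### The Fig. 2 circuit of a list of functions, and its composition law -/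

/-- The Fig. 2 circuit of a *list* of Boolean functions `[g₀, …, g_{k-1}]` on `N` bits:
`H^{⊗N} U_{g_{k-1}} H^{⊗N} ⋯ H^{⊗N} U_{g₀} H^{⊗N}` (head applied first), by recursion on the list
from the head: `F([]) = H^{⊗N}`, `F(g :: gs) = F(gs) · U_g · H^{⊗N}`.
[cite: AaronsonAmbainis2018, §3.2 (Fig. 2) and §6] -/
def forrelationCircuitL : List ((Fin N → Bool) → Bool) → Matrix (QReg N) (QReg N) ℂ
  | [] => hGateAll N
  | g :: gs => forrelationCircuitL gs * phaseLayer g * hGateAll N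

/-- Peeling the last function: `F(gs ++ [g]) = H^{⊗N} U_g F(gs)`. [cite: AaronsonAmbainis2018, §3.2] -/
theorem forrelationCircuitL_append_singleton (gs : List ((Fin N → Bool) → Bool))
    (g : (Fin N → Bool) → Bool) :
    forrelationCircuitL (gs ++ [g]) = hGateAll N * phaseLayer g * forrelationCircuitL gs := by
  induction gs with
  | nil => simp [forrelationCircuitL, mul_assoc]
  | cons g' gs ih =>
    rw [List.cons_append, forrelationCircuitL, ih, forrelationCircuitL]
    simp [mul_assoc]

/-- The Fig. 2 circuit of a tuple is that of the corresponding list.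
[cite: AaronsonAmbainis2018, §3.2] -/
theorem forrelationCircuit_eq_forrelationCircuitL (k : ℕ) (f : Fin k → (Fin N → Bool) → Bool) :
    forrelationCircuit k f = forrelationCircuitL (List.ofFn f) := by
  induction k with
  | zero => rfl
  | succ k ih =>
    rw [forrelationCircuit, List.ofFn_succ', List.concat_eq_append,
      forrelationCircuitL_append_singleton, ih]
    rfl

/-- The constant function `1 = (-1)^0` gives the identity phase layer.
[cite: AaronsonAmbainis2018, §6 (p. 26: "set fᵢ to be the constant 1 function, so that U_{fᵢ} was the identity")] -/
theorem phaseLayer_const_false : phaseLayer (fun _ : Fin N → Bool => false) = 1 := by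
  ext x y
  by_cases h : x = y <;> simp [phaseLayer, signOf, h, Matrix.one_apply]

/-- **Composition law.** A constant function between two lists cancels the two Hadamard layers
around it: `F(f ++ 1 :: g) = F(g) · F(f)`.
[cite: AaronsonAmbainis2018, §6 (p. 26: "every H between U_{f_{i-1}} and U_{fᵢ} would cancel with a corresponding H between U_{fᵢ} and U_{f_{i+1}}")] -/
theorem forrelationCircuitL_append_sep (f g : List ((Fin N → Bool) → Bool)) :
    forrelationCircuitL (f ++ (fun _ => false) :: g) = forrelationCircuitL g * forrelationCircuitL f := by
  induction f with
  | nil => simp only [List.nil_append, forrelationCircuitL, phaseLayer_const_false, mul_one]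
  | cons a f ih =>
    rw [List.cons_append, forrelationCircuitL, ih, forrelationCircuitL]
    simp [mul_assoc]

/-- The block `[1]` is the identity (`H^{⊗N} H^{⊗N} = I`). [cite: AaronsonAmbainis2018, §6 (p. 26)] -/
theorem forrelationCircuitL_sep : forrelationCircuitL [fun _ : Fin N → Bool => false] = 1 := by
  rw [forrelationCircuitL, forrelationCircuitL, phaseLayer_const_false, mul_one, hGateAll_mul_self]

/-- The block `[1, g, 1]` is the bare phase layer `U_g` (how a CCSIGN gate is simulated by a
single `fᵢ`). [cite: AaronsonAmbainis2018, §6 (proof of Thm. 25: "each CSIGN gate is simulated by a single fᵢ")] -/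
theorem forrelationCircuitL_phase_block (g : (Fin N → Bool) → Bool) :
    forrelationCircuitL [fun _ => false, g, fun _ => false] = phaseLayer g := by
  rw [forrelationCircuitL, forrelationCircuitL, forrelationCircuitL_sep, phaseLayer_const_false,
    one_mul, mul_one, mul_assoc, hGateAll_mul_self, mul_one]

/-- The block `[g, g, g]` is the gadget word `H U_g H U_g H U_g H`.
[cite: AaronsonAmbainis2018, §6 (proof of Thm. 25, Fig. 3)] -/
theorem forrelationCircuitL_triple (g : (Fin N → Bool) → Bool) :
    forrelationCircuitL [g, g, g] =
      hGateAll N * phaseLayer g * hGateAll N * phaseLayer g * hGateAll N * phaseLayer g * hGateAll N := by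
  simp only [forrelationCircuitL, mul_assoc]

/-! ### `H^{⊗N}` factors along any set of wires -/

/-- The increasing enumeration of the wires NOT in the range of `e` (the complementary
embedding). [folklore] -/
def complWireEmb (e : Fin k ↪ Fin N) : Fin ((Finset.univ.map e)ᶜ.card) ↪ Fin N :=
  ((Finset.univ.map e)ᶜ.orderEmbOfFin rfl).toEmbedding

/-- The complementary embedding enumerates exactly the other wires. [folklore] -/
theorem range_complWireEmb (e : Fin k ↪ Fin N) : Set.range (complWireEmb e) = (Set.range e)ᶜ := by
  rw [complWireEmb, RelEmbedding.coe_toEmbedding, Finset.range_orderEmbOfFin, Finset.coe_compl,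
    Finset.coe_map, Finset.coe_univ, Set.image_univ]

/-- The two wire sets are disjoint. [folklore] -/
theorem disjoint_range_complWireEmb (e : Fin k ↪ Fin N) :
    Disjoint (Set.range e) (Set.range (complWireEmb e)) := by
  rw [range_complWireEmb]
  exact disjoint_compl_right

/-- Every wire is in one of the two sets. [folklore] -/
theorem mem_range_or_mem_range_complWireEmb (e : Fin k ↪ Fin N) (i : Fin N) :
    i ∈ Set.range e ∨ i ∈ Set.range (complWireEmb e) := by
  rw [range_complWireEmb]
  exact em _

/-- A product over all wires splits along `e` and its complement. [folklore] -/
theorem prod_eq_prod_embedding_mul_prod_complWireEmb (e : Fin k ↪ Fin N) (φ : Fin N → ℂ) :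
    ∏ i, φ i = (∏ j, φ (e j)) * ∏ l, φ (complWireEmb e l) := by
  rw [← Finset.prod_mul_prod_compl (Finset.univ.map e) φ, Finset.prod_map]
  congr 1
  rw [← Finset.prod_coe_sort]
  exact (Fintype.prod_equiv ((Finset.univ.map e)ᶜ.orderIsoOfFin rfl).toEquiv _ _ fun l => rfl).symm

/-- The number of other wires is `N - k`. [folklore] -/
theorem card_compl_map (e : Fin k ↪ Fin N) : (Finset.univ.map e)ᶜ.card = N - k := by
  rw [Finset.card_compl, Finset.card_map, Finset.card_univ, Fintype.card_fin, Fintype.card_fin]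

/-- **`H^{⊗N}` factors along any set of wires**: `H^{⊗N} = (H^{⊗k})_e · (H^{⊗(N-k)})_{eᶜ}`
(the tensor power splits as a tensor product; entrywise, the product over all wires splits).
[cite: NielsenChuang2010, §1.4.4 eq. (1.50) and §4.2] -/
theorem hGateAll_eq_placeGate_mul_placeGate (e : Fin k ↪ Fin N) :
    hGateAll N = placeGate e (hGateAll k) * placeGate (complWireEmb e) (hGateAll _) := by
  ext x y
  rw [placeGate_mul_placeGate_apply_of_disjoint e (complWireEmb e) (disjoint_range_complWireEmb e),
    if_pos, hGateAll_apply_eq_prod, hGateAll_apply_eq_prod, hGateAll_apply_eq_prod,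
    prod_eq_prod_embedding_mul_prod_complWireEmb e]
  · rfl
  · intro i hi hi'
    exact absurd (mem_range_or_mem_range_complWireEmb e i) (by tauto)

/-! ### The gadget on `N` wires -/

/-- The wires of `pairEmb p d` (the library's embedding of two distinct wires,
`ReversibleCliffordT.lean`) are `p` and `d`. [folklore] -/
theorem mem_range_pairEmb_iff (p d : Fin N) (h : p ≠ d) (i : Fin N) :
    i ∈ Set.range (pairEmb p d h) ↔ i = p ∨ i = d := by
  rw [range_pairEmb, Set.mem_insert_iff, Set.mem_singleton_iff]

/-- The CSIGN phase function `(-1)^{z_p z_d}` of the gadget. [cite: AaronsonAmbainis2018, §6 (proof of Thm. 25: "fᵢ(z₁,…,z_n) := (-1)^{z_a z_b}")] -/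
def csignFun (p d : Fin N) : (Fin N → Bool) → Bool := fun z => z p && z d

/-- The CSIGN phase layer on wires `p ≠ d` is the placement of the two-qubit controlled-`Z`
gate `cz`. [cite: AaronsonAmbainis2018, §6 (proof of Thm. 25)] -/
theorem phaseLayer_csignFun (p d : Fin N) (h : p ≠ d) :
    phaseLayer (csignFun p d) = placeGate (pairEmb p d h) cz := by
  rw [← phaseLayer_and_eq_cz, phaseLayer, phaseLayer, placeGate_diagonal]
  rfl

/-- **The gadget on `N` wires.** With `C` the CSIGN phase layer on two distinct wires `p, d`
of an `N`-qubit register, `H^{⊗N} C H^{⊗N} C H^{⊗N} C H^{⊗N}` is `SWAP · H^{⊗2}` on the wires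
`p, d` and the identity elsewhere: the Hadamards on the other wires cancel in pairs
(`H^{⊗N}` factors, `hGateAll_eq_placeGate_mul_placeGate`), and on `p, d` this is the printed
`4 × 4` identity (`hadamard_gadget_qReg`). [cite: AaronsonAmbainis2018, §6 (proof of Thm. 25, p. 27)] -/
theorem gadget_eq_placeGate (p d : Fin N) (h : p ≠ d) :
    hGateAll N * phaseLayer (csignFun p d) * hGateAll N * phaseLayer (csignFun p d) * hGateAll N *
        phaseLayer (csignFun p d) * hGateAll N =
      placeGate (pairEmb p d h) (swapLayer * hGateAll 2) := by
  have hdisj := disjoint_range_complWireEmb (pairEmb p d h)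
  have hRC : ∀ X : Matrix (QReg N) (QReg N) ℂ,
      X * placeGate (complWireEmb (pairEmb p d h)) (hGateAll _) * placeGate (pairEmb p d h) cz =
        X * placeGate (pairEmb p d h) cz * placeGate (complWireEmb (pairEmb p d h)) (hGateAll _) := by
    intro X
    rw [mul_assoc, mul_assoc, placeGate_comm_of_disjoint_holds _ _ hdisj]
  have hRP : ∀ X : Matrix (QReg N) (QReg N) ℂ,
      X * placeGate (complWireEmb (pairEmb p d h)) (hGateAll _) * placeGate (pairEmb p d h) (hGateAll 2) =
        X * placeGate (pairEmb p d h) (hGateAll 2) * placeGate (complWireEmb (pairEmb p d h)) (hGateAll _) := by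
    intro X
    rw [mul_assoc, mul_assoc, placeGate_comm_of_disjoint_holds _ _ hdisj]
  have hRR : ∀ X : Matrix (QReg N) (QReg N) ℂ,
      X * placeGate (complWireEmb (pairEmb p d h)) (hGateAll _) *
        placeGate (complWireEmb (pairEmb p d h)) (hGateAll _) = X := by
    intro X
    rw [mul_assoc, ← placeGate_mul_holds, hGateAll_mul_self, placeGate_one, mul_one]
  rw [phaseLayer_csignFun p d h, hGateAll_eq_placeGate_mul_placeGate (pairEmb p d h)]
  simp only [← mul_assoc]
  simp only [hRC, hRP, hRR]
  rw [← placeGate_mul_holds, ← placeGate_mul_holds, ← placeGate_mul_holds, ← placeGate_mul_holds,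
    ← placeGate_mul_holds, ← placeGate_mul_holds, hadamard_gadget_qReg]

/-- Entries of `SWAP · H^{⊗2}`: `⟨u| SWAP H^{⊗2} |v⟩ = ⟨u₁|H|v₀⟩⟨u₀|H|v₁⟩`.
[cite: AaronsonAmbainis2018, §6 (proof of Thm. 25, p. 27)] -/
theorem swapLayer_mul_hGateAll_two_apply (u v : QReg 2) :
    (swapLayer * hGateAll 2) u v = hadamardEntry (u 1) (v 0) * hadamardEntry (u 0) (v 1) := by
  rw [Matrix.mul_apply, Finset.sum_eq_single (![u 1, u 0] : QReg 2)]
  · rw [hGateAll_apply_eq_prod, Fin.prod_univ_two]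
    simp [swapLayer]
  · intro t _ ht
    have : ¬ (u 0 = t 1 ∧ u 1 = t 0) := by
      rintro ⟨h0, h1⟩
      exact ht (funext fun i => by fin_cases i <;> simp [h0, h1])
    simp [swapLayer, this]
  · intro h
    exact absurd (Finset.mem_univ _) h


/-! ### Small registers: sums over one and two wires -/

/-- Sums over a one-wire register are sums over a bit. [folklore] -/
theorem sum_qReg_one {M : Type*} [AddCommMonoid M] (Φ : QReg 1 → M) :
    ∑ z, Φ z = ∑ b : Bool, Φ (fun _ => b) :=
  Fintype.sum_equiv (Equiv.funUnique (Fin 1) Bool) _ _ fun z => by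
    congr 1
    funext i
    rw [Subsingleton.elim i default]
    rfl

/-- Sums over a two-wire register are double sums over bits. [folklore] -/
theorem sum_qReg_two {M : Type*} [AddCommMonoid M] (Φ : QReg 2 → M) :
    ∑ z, Φ z = ∑ a : Bool, ∑ b : Bool, Φ ![a, b] := by
  rw [← Fintype.sum_prod_type']
  exact Fintype.sum_equiv (finTwoArrowEquiv Bool) _ _ fun z => by
    congr 1
    funext i
    fin_cases i <;> simp

/-- Overwriting along a one-wire embedding is a single update. [folklore] -/
theorem extend_fin_one (e : Fin 1 ↪ Fin N) (z : QReg 1) (v : QReg N) :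
    Function.extend e z v = Function.update v (e 0) (z 0) := by
  funext i
  by_cases hi : i = e 0
  · subst hi
    rw [Function.update_self, e.injective.extend_apply]
  · rw [Function.update_of_ne hi, extend_apply_of_not_mem]
    rintro ⟨j, rfl⟩
    exact hi (by rw [Subsingleton.elim j 0])

/-- Overwriting along `pairEmb p d` is a double update. [folklore] -/
theorem extend_pairEmb (p d : Fin N) (h : p ≠ d) (z : QReg 2) (v : QReg N) :
    Function.extend (pairEmb p d h) z v = Function.update (Function.update v p (z 0)) d (z 1) := by
  funext i
  by_cases hd : i = d
  · rw [hd, Function.update_self]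
    exact (pairEmb p d h).injective.extend_apply _ _ 1
  · rw [Function.update_of_ne hd]
    by_cases hp : i = p
    · rw [hp, Function.update_self]
      exact (pairEmb p d h).injective.extend_apply _ _ 0
    · rw [Function.update_of_ne hp, extend_apply_of_not_mem]
      rw [mem_range_pairEmb_iff]
      tauto

/-- `H H^m = H^{m+1}` entrywise (the recursion of `hadamardPow` multiplies on the other side; both agree
since all factors are the same matrix). [cite: NielsenChuang2010, §1.3.1] -/
theorem sum_hadamardEntry_mul_hadamardPow (m : ℕ) (a b : Bool) :
    ∑ c, hadamardEntry a c * hadamardPow m c b = hadamardPow (m + 1) a b := by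
  induction m generalizing a b with
  | zero =>
    change ∑ c, hadamardEntry a c * (if c = b then 1 else 0) = ∑ c, (if a = c then 1 else 0) * hadamardEntry c b
    simp [Finset.sum_ite_eq, Finset.sum_ite_eq']
  | succ m ih =>
    change ∑ c, hadamardEntry a c * ∑ c', hadamardPow m c c' * hadamardEntry c' b = ∑ c', hadamardPow (m + 1) a c' * hadamardEntry c' b
    simp_rw [Finset.mul_sum, ← mul_assoc]
    rw [Finset.sum_comm]
    simp_rw [← Finset.sum_mul, ih]

/-! ### Wire bookkeeping

The reduction keeps track of which physical wire carries which logical qubit (or the dummy) as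
an explicit bijection `σ : Fin N ≃ Option (Fin n)`; a Hadamard gate on logical qubit `a`,
simulated by the gadget on the wires `σ.pos a` and `σ.dum`, swaps the roles of these two wires
(AA: "we can keep track of it by simply swapping the labels of a and b whenever the gadget is
applied"). -/

/-- A wire bookkeeping of `n` logical qubits and a dummy on `N` physical wires: the physical
wire `i` carries the logical qubit `a` if `σ i = some a` and the dummy if `σ i = none`.
[cite: AaronsonAmbainis2018, §6 (proof of Thm. 25: "swapping the labels")] -/
abbrev WireConfig (n N : ℕ) : Type := Fin N ≃ Option (Fin n)

namespace WireConfig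

variable (σ : WireConfig n N)

/-- The physical wire of the logical qubit `a`. [cite: AaronsonAmbainis2018, §6 (proof of Thm. 25)] -/
def pos (a : Fin n) : Fin N := σ.symm (some a)

/-- The physical wire of the dummy qubit. [cite: AaronsonAmbainis2018, §6 (proof of Thm. 25)] -/
def dum : Fin N := σ.symm none

/-- The logical register carried by a physical register. [cite: AaronsonAmbainis2018, §6 (proof of Thm. 25)] -/
def read (x : QReg N) : QReg n := fun a => x (σ.pos a)

/-- Distinct logical qubits sit on distinct wires. [folklore] -/
theorem pos_injective : Function.Injective σ.pos := fun _ _ h =>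
  Option.some_injective _ (σ.symm.injective h)

/-- No logical qubit sits on the dummy's wire. [folklore] -/
theorem pos_ne_dum (a : Fin n) : σ.pos a ≠ σ.dum := fun h =>
  Option.some_ne_none a (σ.symm.injective h)

/-- Every physical wire carries a logical qubit or the dummy. [folklore] -/
theorem eq_pos_or_eq_dum (i : Fin N) : (∃ a, i = σ.pos a) ∨ i = σ.dum := by
  rcases h : σ i with _ | a
  · right
    apply σ.injective
    rw [h, dum, Equiv.apply_symm_apply]
  · left
    exact ⟨a, σ.injective (by rw [h, pos, Equiv.apply_symm_apply])⟩

/-- A physical register is determined by its logical readout and its dummy bit. [folklore] -/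
theorem ext_of_read {x y : QReg N} (h1 : σ.read x = σ.read y) (h2 : x σ.dum = y σ.dum) :
    x = y := by
  funext i
  rcases σ.eq_pos_or_eq_dum i with ⟨a, rfl⟩ | rfl
  · exact congrFun h1 a
  · exact h2

/-- The all-zero physical register reads as the all-zero logical register. [folklore] -/
@[simp] theorem read_zero : σ.read (fun _ => false) = fun _ => false := rfl

/-- A product over the physical wires is the product over the logical positions times the
dummy's factor. [folklore] -/
theorem prod_eq_prod_pos_mul (φ : Fin N → ℂ) : ∏ i, φ i = (∏ a, φ (σ.pos a)) * φ σ.dum := by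
  rw [← Fintype.prod_equiv σ.symm (fun o => φ (σ.symm o)) φ fun _ => rfl, Fintype.prod_option,
    mul_comm]
  rfl

/-- A sum over physical registers is a double sum over logical readouts and dummy bits.
[folklore] -/
theorem sum_eq_sum_sum {M : Type*} [AddCommMonoid M] (Ψ : QReg n → Bool → M) :
    ∑ w : QReg N, Ψ (σ.read w) (w σ.dum) = ∑ u : QReg n, ∑ b : Bool, Ψ u b := by
  let E : QReg N ≃ Bool × QReg n :=
    (Equiv.arrowCongr σ (Equiv.refl Bool)).trans (Equiv.piOptionEquivProd (β := fun _ => Bool))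
  rw [Fintype.sum_equiv E (fun w => Ψ (σ.read w) (w σ.dum)) (fun q => Ψ q.2 q.1) fun w => rfl,
    Fintype.sum_prod_type, Finset.sum_comm]

/-- **The label swap.** After a Hadamard gadget on the logical qubit `a` (wires `σ.pos a` and
`σ.dum`), the Hadamarded qubit `a` sits on the old dummy wire and the (Hadamarded) dummy on the
old wire of `a`. [cite: AaronsonAmbainis2018, §6 (proof of Thm. 25: "swapping the labels of a and b whenever the gadget is applied")] -/
def hStep (a : Fin n) : WireConfig n N := (Equiv.swap (σ.pos a) σ.dum).trans σ

/-- After the swap, `a` sits on the old dummy wire. [cite: AaronsonAmbainis2018, §6 (proof of Thm. 25)] -/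
theorem hStep_pos_self (a : Fin n) : (σ.hStep a).pos a = σ.dum := by
  change Equiv.swap (σ.pos a) σ.dum (σ.symm (some a)) = _
  exact Equiv.swap_apply_left _ _

/-- The other logical qubits do not move. [cite: AaronsonAmbainis2018, §6 (proof of Thm. 25)] -/
theorem hStep_pos_of_ne {a b : Fin n} (h : b ≠ a) : (σ.hStep a).pos b = σ.pos b := by
  change Equiv.swap (σ.pos a) σ.dum (σ.symm (some b)) = _
  exact Equiv.swap_apply_of_ne_of_ne (fun h' => h (σ.pos_injective h')) (σ.pos_ne_dum b)

/-- After the swap, the dummy sits on the old wire of `a`. [cite: AaronsonAmbainis2018, §6 (proof of Thm. 25)] -/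
theorem hStep_dum (a : Fin n) : (σ.hStep a).dum = σ.pos a := by
  change Equiv.swap (σ.pos a) σ.dum (σ.symm none) = _
  exact Equiv.swap_apply_right _ _

/-- Reading, after the swap, a register whose wires `σ.pos a` and `σ.dum` were overwritten by
`α` and `β`: the logical readout is the old readout with qubit `a` set to `β`.
[cite: AaronsonAmbainis2018, §6 (proof of Thm. 25)] -/
theorem read_hStep_update_update (a : Fin n) (y : QReg N) (α β : Bool) :
    (σ.hStep a).read (Function.update (Function.update y (σ.pos a) α) σ.dum β) =
      Function.update (σ.read y) a β := by
  funext b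
  by_cases hb : b = a
  · subst hb
    rw [read, hStep_pos_self, Function.update_self, Function.update_self]
  · rw [read, hStep_pos_of_ne σ hb, Function.update_of_ne hb, Function.update_of_ne (σ.pos_ne_dum b),
      Function.update_of_ne (σ.pos_injective.ne hb)]
    rfl

/-- … and its bit on the new dummy wire (the old wire of `a`) is `α`. [cite: AaronsonAmbainis2018, §6 (proof of Thm. 25)] -/
theorem update_update_apply_hStep_dum (a : Fin n) (y : QReg N) (α β : Bool) :
    (Function.update (Function.update y (σ.pos a) α) σ.dum β) ((σ.hStep a).dum) = α := by
  rw [hStep_dum, Function.update_of_ne (σ.pos_ne_dum a), Function.update_self]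

end WireConfig

/-! ### The translation of a circuit, gate by gate -/

/-- The placement of an `H` gate of `hCCSign` as a one-wire embedding (the arity of `H`
unfolded to `1`). [folklore] -/
abbrev hPlacement (e : Fin (hCCSign.arity HCCSignOp.H) ↪ Fin n) : Fin 1 ↪ Fin n := e

/-- The placement of a `CCSIGN` gate of `hCCSign` as a three-wire embedding (the arity of
`CCSIGN` unfolded to `3`). [folklore] -/
abbrev ccsignPlacement (e : Fin (hCCSign.arity HCCSignOp.CCSIGN) ↪ Fin n) : Fin 3 ↪ Fin n := e

/-- The matrix of a placed `H` gate of `hCCSign`, with the arity unfolded. [folklore] -/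
theorem toMatrix_gate_H (A : Language Bool) (e : Fin (hCCSign.arity HCCSignOp.H) ↪ Fin n) :
    (QGate.gate HCCSignOp.H e : QGate hCCSign n).toMatrix A = placeGate (hPlacement e) hGate := rfl

/-- The matrix of a placed `CCSIGN` gate of `hCCSign`, with the arity unfolded. [folklore] -/
theorem toMatrix_gate_CCSIGN (A : Language Bool) (e : Fin (hCCSign.arity HCCSignOp.CCSIGN) ↪ Fin n) :
    (QGate.gate HCCSignOp.CCSIGN e : QGate hCCSign n).toMatrix A = placeGate (ccsignPlacement e) ccsign := rfl

/-- The CCSIGN phase function `(-1)^{z_a z_b z_c}` of a CCSIGN gate on the logical qubits `e`,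
read on the physical wires. [cite: AaronsonAmbainis2018, §6 (proof of Thm. 25: "(-1)^{z_a z_b z_c}")] -/
def ccsignFun (σ : WireConfig n N) (e : Fin 3 ↪ Fin n) : (Fin N → Bool) → Bool :=
  fun z => z (σ.pos (e 0)) && (z (σ.pos (e 1)) && z (σ.pos (e 2)))

/-- The block of functions simulating one gate: a Hadamard on `a` becomes the gadget
`[C, C, C]` with `C = (-1)^{z_{pos a} z_{dum}}`; a CCSIGN becomes `[1, (-1)^{z_a z_b z_c}, 1]`
(the constant functions cancel the automatic Hadamard layers); oracle gates (absent from
`{H, CCSIGN}` circuits proper) are sent to the identity block.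
[cite: AaronsonAmbainis2018, §6 (proof of Thm. 25)] -/
def forrGateBlock (σ : WireConfig n N) : QGate hCCSign n → List ((Fin N → Bool) → Bool)
  | .gate HCCSignOp.H e =>
      [csignFun (σ.pos (hPlacement e 0)) σ.dum, csignFun (σ.pos (hPlacement e 0)) σ.dum,
        csignFun (σ.pos (hPlacement e 0)) σ.dum]
  | .gate HCCSignOp.CCSIGN e => [fun _ => false, ccsignFun σ (ccsignPlacement e), fun _ => false]
  | .oracle _ _ => [fun _ => false, fun _ => false, fun _ => false]

/-- The bookkeeping after one gate (labels swap after a Hadamard). [cite: AaronsonAmbainis2018, §6 (proof of Thm. 25)] -/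
def forrGateStep (σ : WireConfig n N) : QGate hCCSign n → WireConfig n N
  | .gate HCCSignOp.H e => σ.hStep (hPlacement e 0)
  | .gate HCCSignOp.CCSIGN _ => σ
  | .oracle _ _ => σ

/-- **The translation of a gate list** (head = first gate applied): the identity block `[1]`
for the empty circuit, and for each gate its block followed by a separating constant function.
[cite: AaronsonAmbainis2018, §6 (proof of Thm. 25: "we insert an fᵢ = 1 in between them, in order to cancel the unwanted Hadamards")] -/
def forrBuild : List (QGate hCCSign n) → WireConfig n N → List ((Fin N → Bool) → Bool)
  | [], _ => [fun _ => false]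
  | g :: gs, σ => forrGateBlock σ g ++ (fun _ => false) :: forrBuild gs (forrGateStep σ g)

/-- The bookkeeping after a whole gate list. [cite: AaronsonAmbainis2018, §6 (proof of Thm. 25)] -/
def forrFinal : List (QGate hCCSign n) → WireConfig n N → WireConfig n N
  | [], σ => σ
  | g :: gs, σ => forrFinal gs (forrGateStep σ g)

/-- The number of Hadamard gates in a gate list. [cite: AaronsonAmbainis2018, §6 (proof of Thm. 25)] -/
def hadamardCount : List (QGate hCCSign n) → ℕ
  | [] => 0
  | .gate HCCSignOp.H _ :: gs => hadamardCount gs + 1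
  | .gate HCCSignOp.CCSIGN _ :: gs => hadamardCount gs
  | .oracle _ _ :: gs => hadamardCount gs

/-- The translation uses `4m + 1` functions for `m` gates. [cite: AaronsonAmbainis2018, §6 (Thm. 25: "k = O(m)")] -/
theorem length_forrBuild (gs : List (QGate hCCSign n)) (σ : WireConfig n N) :
    (forrBuild gs σ).length = 4 * gs.length + 1 := by
  induction gs generalizing σ with
  | nil => rfl
  | cons g gs ih =>
    rcases g with ⟨_ | _, e⟩ | ⟨m, e⟩ <;>
      simp only [forrBuild, forrGateBlock, List.length_append, List.length_cons, ih] <;> simp <;> ring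

/-- The number of Hadamard gates is additive. [folklore] -/
theorem hadamardCount_append (gs gs' : List (QGate hCCSign n)) :
    hadamardCount (gs ++ gs') = hadamardCount gs + hadamardCount gs' := by
  induction gs with
  | nil => simp [hadamardCount]
  | cons g gs ih =>
    rcases g with ⟨_ | _, e⟩ | ⟨m, e⟩
    · simp only [List.cons_append, hadamardCount, ih]
      ring
    · simp only [List.cons_append, hadamardCount, ih]
    · simp only [List.cons_append, hadamardCount, ih]

/-- The CSIGN phase of the gadget is the product of two input bits. [cite: AaronsonAmbainis2018, §6 (Thm. 25)] -/
theorem isFewBitProduct_csignFun (p d : Fin N) (h : p ≠ d) : IsFewBitProduct (csignFun p d) :=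
  ⟨{p, d}, by rw [Finset.card_pair h]; norm_num, fun z => by simp [csignFun]⟩

/-- The CCSIGN phase is the product of three input bits. [cite: AaronsonAmbainis2018, §6 (Thm. 25)] -/
theorem isFewBitProduct_ccsignFun (σ : WireConfig n N) (e : Fin 3 ↪ Fin n) :
    IsFewBitProduct (ccsignFun σ e) :=
  ⟨{σ.pos (e 0), σ.pos (e 1), σ.pos (e 2)}, Finset.card_le_three, fun z => by simp [ccsignFun]⟩

/-- **Every function produced by the translation is `1`, `(-1)^{z_a z_b}` or `(-1)^{z_a z_b z_c}`.**
[cite: AaronsonAmbainis2018, §6 (Thm. 25, "Moreover" clause)] -/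
theorem isFewBitProduct_of_mem_forrBuild (gs : List (QGate hCCSign n)) (σ : WireConfig n N) :
    ∀ g ∈ forrBuild gs σ, IsFewBitProduct g := by
  induction gs generalizing σ with
  | nil =>
    intro g hg
    obtain rfl : g = fun _ => false := by simpa [forrBuild] using hg
    exact isFewBitProduct_const_false N
  | cons g gs ih =>
    intro g' hg'
    rcases g with ⟨_ | _, e⟩ | ⟨m, e⟩
    · simp only [forrBuild, forrGateBlock, List.cons_append, List.nil_append, List.mem_cons] at hg'
      rcases hg' with rfl | rfl | rfl | rfl | hg'
      · exact isFewBitProduct_csignFun _ _ (σ.pos_ne_dum _)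
      · exact isFewBitProduct_csignFun _ _ (σ.pos_ne_dum _)
      · exact isFewBitProduct_csignFun _ _ (σ.pos_ne_dum _)
      · exact isFewBitProduct_const_false N
      · exact ih _ g' hg'
    · simp only [forrBuild, forrGateBlock, List.cons_append, List.nil_append, List.mem_cons] at hg'
      rcases hg' with rfl | rfl | rfl | rfl | hg'
      · exact isFewBitProduct_const_false N
      · exact isFewBitProduct_ccsignFun σ (ccsignPlacement e)
      · exact isFewBitProduct_const_false N
      · exact isFewBitProduct_const_false N
      · exact ih _ g' hg'
    · simp only [forrBuild, forrGateBlock, List.cons_append, List.nil_append, List.mem_cons] at hg'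
      rcases hg' with rfl | rfl | rfl | rfl | hg'
      · exact isFewBitProduct_const_false N
      · exact isFewBitProduct_const_false N
      · exact isFewBitProduct_const_false N
      · exact isFewBitProduct_const_false N
      · exact ih _ g' hg'

/-- `(-1)^{z_a z_b z_c}` read through the bookkeeping is the diagonal of the placed CCSIGN gate.
[cite: AaronsonAmbainis2018, §6 (p. 26, CCSIGN)] -/
theorem signOf_ccsignFun (σ : WireConfig n N) (e : Fin 3 ↪ Fin n) (y : QReg N) :
    ((signOf (ccsignFun σ e y)) : ℂ) =
      if (σ.read y ∘ e) 0 = true ∧ (σ.read y ∘ e) 1 = true ∧ (σ.read y ∘ e) 2 = true then -1 else 1 := by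
  simp only [ccsignFun, signOf, Function.comp_apply, WireConfig.read, Bool.and_eq_true]
  split_ifs <;> simp

/-- **The invariant of the translation (AA Thm. 25, proof).** For an oracle-free gate list `gs`
started in the bookkeeping `σ`, the Fig. 2 circuit of `forrBuild gs σ` has the entries
`⟨x| F |y⟩ = ⟨read_{σ'} x| U_{gs} |read_σ y⟩ · ⟨x_{dum σ'}| H^h |y_{dum σ}⟩`, where `σ'` is the
final bookkeeping and `h` the number of Hadamard gates: the circuit acts as `gs` on the logical
qubits (up to the relabelling of wires) and as `H^h` on the dummy.
[cite: AaronsonAmbainis2018, §6 (proof of Thm. 25, pp. 26–27)] -/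
theorem forrBuild_spec (gs : List (QGate hCCSign n)) (hgs : ∀ g ∈ gs, g.IsOracleFree) (σ : WireConfig n N)
    (x y : QReg N) :
    forrelationCircuitL (forrBuild gs σ) x y =
      (⟨gs⟩ : QCircuit hCCSign n).toMatrix 0 ((forrFinal gs σ).read x) (σ.read y) *
        hadamardPow (hadamardCount gs) (x (forrFinal gs σ).dum) (y σ.dum) := by
  induction gs generalizing σ y with
  | nil =>
    simp only [forrBuild, forrFinal, hadamardCount, forrelationCircuitL_sep, QCircuit.toMatrix_nil, hadamardPow,
      Matrix.one_apply]
    by_cases hxy : x = y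
    · subst hxy
      simp
    · rw [if_neg hxy]
      by_cases h1 : σ.read x = σ.read y
      · have h2 : x σ.dum ≠ y σ.dum := fun h2 => hxy (σ.ext_of_read h1 h2)
        simp [h2]
      · simp [h1]
  | cons g gs ih =>
    have hg : g.IsOracleFree := hgs g (by simp)
    have hgs' : ∀ g' ∈ gs, g'.IsOracleFree := fun g' h => hgs g' (by simp [h])
    rcases g with ⟨_ | _, e⟩ | ⟨m, e⟩
    · -- a Hadamard gate on the logical qubit `hPlacement e 0`: the gadget
      simp only [forrBuild, forrGateBlock, forrGateStep, forrFinal, hadamardCount]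
      rw [List.cons_append, List.cons_append, List.cons_append, List.nil_append,
        show (csignFun (σ.pos (hPlacement e 0)) σ.dum :: csignFun (σ.pos (hPlacement e 0)) σ.dum ::
            csignFun (σ.pos (hPlacement e 0)) σ.dum :: (fun _ => false) :: forrBuild gs (σ.hStep (hPlacement e 0))) =
          [csignFun (σ.pos (hPlacement e 0)) σ.dum, csignFun (σ.pos (hPlacement e 0)) σ.dum,
            csignFun (σ.pos (hPlacement e 0)) σ.dum] ++ (fun _ => false) :: forrBuild gs (σ.hStep (hPlacement e 0))
          from rfl,
        forrelationCircuitL_append_sep, forrelationCircuitL_triple,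
        gadget_eq_placeGate _ _ (σ.pos_ne_dum _), mul_placeGate_apply, sum_qReg_two]
      simp only [extend_pairEmb, swapLayer_mul_hGateAll_two_apply, ih hgs']
      rw [QCircuit.toMatrix_cons, toMatrix_gate_H, mul_placeGate_apply, sum_qReg_one, hadamardPow,
        Finset.sum_mul_sum, Finset.sum_comm]
      refine Finset.sum_congr rfl fun a _ => Finset.sum_congr rfl fun b _ => ?_
      simp only [WireConfig.read_hStep_update_update, WireConfig.update_update_apply_hStep_dum,
        extend_fin_one, hGate_apply_eq_hadamardEntry, Matrix.cons_val_zero, Matrix.cons_val_one,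
        Function.comp_apply, pairEmb_zero, pairEmb_one]
      change _ = (⟨gs⟩ : QCircuit hCCSign n).toMatrix 0 _ (Function.update (σ.read y) (hPlacement e 0) a) *
          hadamardEntry a (y (σ.pos (hPlacement e 0))) * (hadamardPow (hadamardCount gs) (x (forrFinal gs (σ.hStep (hPlacement e 0))).dum) b *
            hadamardEntry b (y σ.dum))
      ring
    · -- a CCSIGN gate: a single phase layer
      simp only [forrBuild, forrGateBlock, forrGateStep, forrFinal, hadamardCount]
      rw [List.cons_append, List.cons_append, List.cons_append, List.nil_append,
        show ((fun _ => false) :: ccsignFun σ (ccsignPlacement e) :: (fun _ => false) :: (fun _ => false) ::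
            forrBuild gs σ) =
          [fun _ => false, ccsignFun σ (ccsignPlacement e), fun _ => false] ++ (fun _ => false) :: forrBuild gs σ
          from rfl,
        forrelationCircuitL_append_sep, forrelationCircuitL_phase_block, phaseLayer,
        Matrix.mul_diagonal, ih hgs' σ y, QCircuit.toMatrix_cons, toMatrix_gate_CCSIGN, ccsign,
        placeGate_diagonal, Matrix.mul_diagonal, signOf_ccsignFun]
      ring
    · exact absurd hg id

/-- **`Φ = A_Q` for circuits with an even number of Hadamard gates (the printed construction
verbatim):** the `⟨0…0|·|0…0⟩` entry of the Fig. 2 circuit of `forrBuild Q σ` is `A_Q`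
(the all-zero register reads as all-zero in any bookkeeping, and `⟨0|H^h|0⟩ = 1` for even `h`).
[cite: AaronsonAmbainis2018, §6 (proof of Thm. 25)] -/
theorem forrBuild_apply_zero_zero_of_even (Q : QCircuit hCCSign n) (hQ : Q.IsOracleFree)
    (σ : WireConfig n N) (he : Even (hadamardCount Q.gates)) :
    forrelationCircuitL (forrBuild Q.gates σ) (fun _ => false) (fun _ => false) =
      Q.mat (fun _ => false) (fun _ => false) := by
  rw [forrBuild_spec Q.gates hQ σ, hadamardPow_of_even he, if_pos rfl, mul_one, WireConfig.read_zero,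
    WireConfig.read_zero]

/-! ### The parity repair: an odd number of Hadamard gates -/

/-- The Hadamard gate of `{H, CCSIGN}` on the logical qubit `a`. [cite: AaronsonAmbainis2018, §6] -/
def hCCSignHOn (a : Fin n) : QGate hCCSign n :=
  QGate.gate HCCSignOp.H (wireEmb a)

/-- One Hadamard gate on every qubit (the padding of the parity repair). [cite: AaronsonAmbainis2018, §6 (proof of Thm. 25)] -/
def hOnAllWires (n : ℕ) : List (QGate hCCSign n) :=
  (List.finRange n).map hCCSignHOn

/-- The padding consists of `n` Hadamard gates. [folklore] -/
theorem hadamardCount_hOnAllWires (n : ℕ) : hadamardCount (hOnAllWires n) = n := by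
  unfold hOnAllWires
  suffices h : ∀ ws : List (Fin n), hadamardCount (ws.map hCCSignHOn) = ws.length by
    rw [h, List.length_finRange]
  intro ws
  induction ws with
  | nil => rfl
  | cons a ws ih =>
    rw [List.map_cons, hCCSignHOn, List.length_cons, ← ih]
    rfl

/-- The padding gates are oracle-free. [folklore] -/
theorem isOracleFree_of_mem_hOnAllWires {g : QGate hCCSign n} (hg : g ∈ hOnAllWires n) :
    g.IsOracleFree := by
  unfold hOnAllWires at hg
  obtain ⟨a, -, rfl⟩ := List.mem_map.1 hg
  trivial

/-- Hadamard gates on the distinct logical qubits `ws`, as a matrix: `∏_{a ∈ ws} ⟨x_a|H|y_a⟩` if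
`x` and `y` agree off `ws`, else `0`. [cite: NielsenChuang2010, §1.4.4] -/
theorem toMatrix_map_hCCSignHOn (ws : List (Fin n)) (hws : ws.Nodup) (x y : QReg n) :
    (⟨ws.map hCCSignHOn⟩ : QCircuit hCCSign n).toMatrix 0 x y =
      if (∀ i, i ∉ ws → x i = y i) then (ws.map fun a => hadamardEntry (x a) (y a)).prod else 0 := by
  induction ws generalizing y with
  | nil =>
    simp only [List.map_nil, QCircuit.toMatrix_nil, Matrix.one_apply, List.not_mem_nil,
      not_false_eq_true, forall_const, List.prod_nil]
    simp [funext_iff]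
  | cons a ws ih =>
    have ha : a ∉ ws := (List.nodup_cons.1 hws).1
    rw [List.map_cons, QCircuit.toMatrix_cons, hCCSignHOn, toMatrix_gate_H, mul_placeGate_apply,
      sum_qReg_one, Finset.sum_eq_single (x a)]
    · simp only [extend_fin_one, wireEmb_apply, ih (List.nodup_cons.1 hws).2, hGate_apply_eq_hadamardEntry,
        Function.comp_apply]
      have hP : (ws.map fun a' => hadamardEntry (x a') (Function.update y a (x a) a')).prod =
          (ws.map fun a' => hadamardEntry (x a') (y a')).prod := by
        refine congrArg List.prod (List.map_congr_left fun a' ha' => ?_)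
        rw [Function.update_of_ne (ne_of_mem_of_not_mem ha' ha)]
      by_cases hc : ∀ i, i ∉ a :: ws → x i = y i
      · rw [if_pos hc, if_pos, hP, List.map_cons, List.prod_cons]
        · ring
        · intro i hi
          by_cases hia : i = a
          · subst hia
            simp
          · rw [Function.update_of_ne hia]
            exact hc i (by simp [hia, hi])
      · rw [if_neg hc, if_neg, zero_mul]
        intro h'
        apply hc
        intro i hi
        have hia : i ≠ a := fun h => hi (h ▸ by simp)
        have := h' i fun h => hi (by simp [h])
        rwa [Function.update_of_ne hia] at this
    · intro b _ hb
      simp only [extend_fin_one, wireEmb_apply, ih (List.nodup_cons.1 hws).2]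
      rw [if_neg, zero_mul]
      intro h'
      have := h' a ha
      rw [Function.update_self] at this
      exact hb this.symm
    · intro h
      exact absurd (Finset.mem_univ _) h

/-- **One Hadamard gate on every qubit is `H^{⊗n}`.** [cite: NielsenChuang2010, §1.4.4 eq. (1.50)] -/
theorem toMatrix_hOnAllWires (n : ℕ) :
    (⟨hOnAllWires n⟩ : QCircuit hCCSign n).toMatrix 0 = hGateAll n := by
  ext x y
  rw [hOnAllWires, toMatrix_map_hCCSignHOn _ (List.nodup_finRange n),
    if_pos fun i hi => absurd (List.mem_finRange i) hi, hGateAll_apply_eq_prod, Fin.prod_univ_def]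

/-- **The padded translation** for circuits with an odd number of Hadamard gates (`n` even):
translate `Q` followed by one Hadamard gate on every qubit, and append one more constant
function, i.e. one bare layer `H^{⊗N}`; on the logical qubits the bare layer undoes the padding,
and on the dummy it supplies the missing Hadamard. (This is the repair of the printed
bookkeeping, which leaves the dummy in the state `H|0⟩` when the number of Hadamard gates is
odd.) [cite: AaronsonAmbainis2018, §6 (proof of Thm. 25)] -/
def forrBuildPadded (gs : List (QGate hCCSign n)) (σ : WireConfig n N) : List ((Fin N → Bool) → Bool) :=
  forrBuild (gs ++ hOnAllWires n) σ ++ [fun _ => false]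

/-- The padded translation uses `4(m + n) + 2` functions. [cite: AaronsonAmbainis2018, §6 (Thm. 25)] -/
theorem length_forrBuildPadded (gs : List (QGate hCCSign n)) (σ : WireConfig n N) :
    (forrBuildPadded gs σ).length = 4 * (gs.length + n) + 2 := by
  simp only [forrBuildPadded, List.length_append, length_forrBuild, List.length_append, hOnAllWires,
    List.length_map, List.length_finRange, List.length_singleton]

/-- Every function of the padded translation is `1`, `(-1)^{z_a z_b}` or `(-1)^{z_a z_b z_c}`.
[cite: AaronsonAmbainis2018, §6 (Thm. 25)] -/
theorem isFewBitProduct_of_mem_forrBuildPadded (gs : List (QGate hCCSign n)) (σ : WireConfig n N) :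
    ∀ g ∈ forrBuildPadded gs σ, IsFewBitProduct g := by
  intro g hg
  rw [forrBuildPadded, List.mem_append, List.mem_singleton] at hg
  rcases hg with hg | rfl
  · exact isFewBitProduct_of_mem_forrBuild _ _ g hg
  · exact isFewBitProduct_const_false N

/-- **`Φ = A_Q` by the padded translation** when `h + n + 1` is even (`h` the number of
Hadamard gates): the bare layer `H^{⊗N}` reads as `H^{⊗n}` on the logical qubits, cancelling the
padding `∏ₐ H_a = H^{⊗n}`, times one more `H` on the dummy, so that the dummy's factor is
`⟨0|H^{h+n+1}|0⟩ = 1`. [cite: AaronsonAmbainis2018, §6 (proof of Thm. 25)] -/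
theorem forrBuildPadded_apply_zero_zero (Q : QCircuit hCCSign n) (hQ : Q.IsOracleFree)
    (σ : WireConfig n N) (he : Even (hadamardCount Q.gates + n + 1)) :
    forrelationCircuitL (forrBuildPadded Q.gates σ) (fun _ => false) (fun _ => false) =
      Q.mat (fun _ => false) (fun _ => false) := by
  have hfree : ∀ g ∈ Q.gates ++ hOnAllWires n, g.IsOracleFree := by
    intro g hg
    rcases List.mem_append.1 hg with hg | hg
    · exact hQ g hg
    · exact isOracleFree_of_mem_hOnAllWires hg
  rw [forrBuildPadded, forrelationCircuitL_append_singleton, phaseLayer_const_false, mul_one,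
    Matrix.mul_apply]
  simp_rw [forrBuild_spec _ hfree σ, hGateAll_apply_eq_prod]
  set σ' := forrFinal (Q.gates ++ hOnAllWires n) σ with hσ'
  set M := (⟨Q.gates ++ hOnAllWires n⟩ : QCircuit hCCSign n).toMatrix 0 with hM
  have hsplit : ∀ w : QReg N, (∏ i, hadamardEntry false (w i)) *
      (M (σ'.read w) (σ.read fun _ => false) * hadamardPow (hadamardCount (Q.gates ++ hOnAllWires n)) (w σ'.dum) false) =
      (hGateAll n (fun _ => false) (σ'.read w) * M (σ'.read w) fun _ => false) *
        (hadamardEntry false (w σ'.dum) * hadamardPow (hadamardCount (Q.gates ++ hOnAllWires n)) (w σ'.dum) false) := by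
    intro w
    rw [σ'.prod_eq_prod_pos_mul fun i => hadamardEntry false (w i), hGateAll_apply_eq_prod, WireConfig.read_zero]
    simp only [WireConfig.read]
    ring
  simp_rw [hsplit]
  rw [σ'.sum_eq_sum_sum fun u b => (hGateAll n (fun _ => false) u * M u fun _ => false) *
      (hadamardEntry false b * hadamardPow (hadamardCount (Q.gates ++ hOnAllWires n)) b false)]
  simp_rw [← Finset.mul_sum]
  rw [← Finset.sum_mul, sum_hadamardEntry_mul_hadamardPow, hadamardCount_append, hadamardCount_hOnAllWires, hadamardPow_of_even he,
    if_pos rfl, mul_one, ← Matrix.mul_apply, hM,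
    show (⟨Q.gates ++ hOnAllWires n⟩ : QCircuit hCCSign n) = (⟨Q.gates⟩ : QCircuit hCCSign n).append
      ⟨hOnAllWires n⟩ from rfl,
    QCircuit.toMatrix_append, toMatrix_hOnAllWires, ← mul_assoc, hGateAll_mul_self, one_mul]

/-! ### An idle extra wire (for `n` odd) -/

/-- A gate on `n` wires regarded as a gate on `n + 1` wires (the last wire idle). [folklore] -/
def liftGateSucc {G : QGateSet} : QGate G n → QGate G (n + 1)
  | .gate g e => .gate g (e.trans Fin.castSuccEmb)
  | .oracle m e => .oracle m (e.trans Fin.castSuccEmb)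

/-- The lifted gate acts as the original gate placed on the first `n` wires. [cite: NielsenChuang2010, §4.2] -/
theorem toMatrix_liftGateSucc {G : QGateSet} (A : Language Bool) (g : QGate G n) :
    (liftGateSucc g).toMatrix A = placeGate Fin.castSuccEmb (g.toMatrix A) := by
  cases g with
  | gate g e => rw [liftGateSucc, QGate.toMatrix_gate, QGate.toMatrix_gate, placeGate_placeGate]
  | oracle m e => rw [liftGateSucc, QGate.toMatrix_oracle, QGate.toMatrix_oracle, placeGate_placeGate]

/-- A circuit on `n` wires regarded as a circuit on `n + 1` wires (the last wire idle). [folklore] -/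
def liftCircuitSucc {G : QGateSet} (C : QCircuit G n) : QCircuit G (n + 1) :=
  ⟨C.gates.map liftGateSucc⟩

/-- The lifted circuit acts as the original circuit placed on the first `n` wires. [cite: NielsenChuang2010, §4.2] -/
theorem toMatrix_liftCircuitSucc {G : QGateSet} (A : Language Bool) (C : QCircuit G n) :
    (liftCircuitSucc C).toMatrix A = placeGate Fin.castSuccEmb (C.toMatrix A) := by
  obtain ⟨gs⟩ := C
  induction gs with
  | nil => simp [liftCircuitSucc]
  | cons g gs ih =>
    have ih' : (⟨gs.map liftGateSucc⟩ : QCircuit G (n + 1)).toMatrix A =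
        placeGate Fin.castSuccEmb ((⟨gs⟩ : QCircuit G n).toMatrix A) := ih
    change (⟨liftGateSucc g :: gs.map liftGateSucc⟩ : QCircuit G (n + 1)).toMatrix A = _
    rw [QCircuit.toMatrix_cons, ih', toMatrix_liftGateSucc, QCircuit.toMatrix_cons, placeGate_mul_holds]

/-- Lifting preserves the size. [folklore] -/
@[simp] theorem size_liftCircuitSucc {G : QGateSet} (C : QCircuit G n) : (liftCircuitSucc C).size = C.size := by
  simp [liftCircuitSucc, QCircuit.size]

/-- Lifting preserves oracle-freeness. [folklore] -/
theorem isOracleFree_liftCircuitSucc {G : QGateSet} {C : QCircuit G n} (hC : C.IsOracleFree) :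
    (liftCircuitSucc C).IsOracleFree := by
  intro g hg
  obtain ⟨g', hg', rfl⟩ := List.mem_map.1 hg
  have := hC g' hg'
  cases g' with
  | gate _ _ => trivial
  | oracle _ _ => exact absurd this id

/-- Lifting preserves the number of Hadamard gates. [folklore] -/
theorem hadamardCount_liftCircuitSucc (gs : List (QGate hCCSign n)) : hadamardCount (gs.map liftGateSucc) = hadamardCount gs := by
  induction gs with
  | nil => rfl
  | cons g gs ih => rcases g with ⟨_ | _, e⟩ | ⟨m, e⟩ <;> simp only [List.map_cons, liftGateSucc, hadamardCount, ih]

/-- **Lifting preserves the transition amplitude**: `⟨0ⁿ⁺¹| Q ⊗ I |0ⁿ⁺¹⟩ = ⟨0ⁿ|Q|0ⁿ⟩`. [cite: AaronsonAmbainis2018, §6] -/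
theorem transitionAmplitude_liftCircuitSucc (Q : QCircuit hCCSign n) :
    transitionAmplitude (liftCircuitSucc Q) = transitionAmplitude Q := by
  unfold transitionAmplitude QCircuit.mat
  rw [toMatrix_liftCircuitSucc, placeGate_apply, if_pos fun _ _ => rfl]
  rfl

/-! ### Assembly: the corrected Theorem 25, amplitude form -/

/-- The Forrelation value of (the tuple of) a list of functions is the `⟨0…0|·|0…0⟩` entry of its
Fig. 2 circuit. [cite: AaronsonAmbainis2018, §3.2 (p. 11)] -/
theorem kForrelationValue_list_get (L : List ((Fin N → Bool) → Bool)) :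
    ((kForrelationValue (k := L.length) L.get : ℝ) : ℂ) =
      forrelationCircuitL L (fun _ => false) (fun _ => false) := by
  rw [← forrelationCircuit_apply_zero_zero, forrelationCircuit_eq_forrelationCircuitL, List.ofFn_get]

/-- The initial bookkeeping on `n + 1` wires: logical qubit `a` on wire `a`, the dummy last.
[cite: AaronsonAmbainis2018, §6 (proof of Thm. 25: "a dummy qubit")] -/
def WireConfig.init (n : ℕ) : WireConfig n (n + 1) := finSuccEquivLast

/-- **AA Thm. 25, amplitude form, even number of Hadamard gates (as printed).** For an oracle-free
`n`-qubit circuit `Q` over `{H, CCSIGN}` with `m` gates, `h` of them Hadamard gates with `h`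
even, the `4m + 1` functions `forrBuild Q` on `n + 1` bits (each `1`, `(-1)^{z_az_b}` or
`(-1)^{z_az_bz_c}`) have `Φ = A_Q`. [cite: AaronsonAmbainis2018, §6 Thm. 25 (proof, pp. 26–27)] -/
theorem kForrelationValue_forrBuild_of_even (Q : QCircuit hCCSign n) (hQ : Q.IsOracleFree)
    (he : Even (hadamardCount Q.gates)) :
    kForrelationValue (k := (forrBuild Q.gates (WireConfig.init n)).length) (forrBuild Q.gates (WireConfig.init n)).get =
      transitionAmplitude Q := by
  apply Complex.ofReal_injective
  rw [kForrelationValue_list_get, forrBuild_apply_zero_zero_of_even Q hQ _ he, transitionAmplitude_coe]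

/-- **AA Thm. 25, amplitude form, padded (`h + n` odd).** For an oracle-free `n`-qubit circuit
`Q` over `{H, CCSIGN}` whose number of Hadamard gates has the parity opposite to `n`, the
`4(m + n) + 2` functions `forrBuildPadded Q` on `n + 1` bits have `Φ = A_Q`.
[cite: AaronsonAmbainis2018, §6 Thm. 25 (proof, pp. 26–27)] -/
theorem kForrelationValue_forrBuildPadded (Q : QCircuit hCCSign n) (hQ : Q.IsOracleFree)
    (he : Even (hadamardCount Q.gates + n + 1)) :
    kForrelationValue (k := (forrBuildPadded Q.gates (WireConfig.init n)).length)
        (forrBuildPadded Q.gates (WireConfig.init n)).get = transitionAmplitude Q := by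
  apply Complex.ofReal_injective
  rw [kForrelationValue_list_get, forrBuildPadded_apply_zero_zero Q hQ _ he, transitionAmplitude_coe]

/-- **Aaronson–Ambainis Theorem 25, amplitude form (corrected statement, PROVED).** For every
oracle-free `n`-qubit circuit `Q` over `{H, CCSIGN}` with `m` gates there are `k ≤ 4(m+n+1)+2`
Boolean functions `f₁, …, f_k` on `N ≤ n + 2` bits, each `1`, `(-1)^{z_a z_b}` or
`(-1)^{z_a z_b z_c}` (`IsFewBitProduct`), with `Φ_{f₁,…,f_k} = A_Q` exactly. (`N = n + 1` unless
`n` and the number of Hadamard gates are both odd, in which case an idle wire is added first;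
the printed "`n + 1`, `k = O(m)`" is unattainable in that case, see
`not_exists_kForrelationValue_eq_hadamard`.) [cite: AaronsonAmbainis2018, §6 Thm. 25 (proof, pp. 26–27)] -/
theorem AaronsonAmbainis2018_thm25_amplitude_corrected (n : ℕ) (Q : QCircuit hCCSign n)
    (hQ : Q.IsOracleFree) :
    ∃ (N k : ℕ) (f : Fin k → (Fin N → Bool) → Bool),
      N ≤ n + 2 ∧ k ≤ 4 * (Q.size + n + 1) + 2 ∧ (∀ i, IsFewBitProduct (f i)) ∧
        kForrelationValue f = transitionAmplitude Q := by
  rcases Nat.even_or_odd (hadamardCount Q.gates) with he | ho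
  · refine ⟨n + 1, _, (forrBuild Q.gates (WireConfig.init n)).get, by omega, ?_, ?_,
      kForrelationValue_forrBuild_of_even Q hQ he⟩
    · rw [length_forrBuild]
      change 4 * Q.size + 1 ≤ _
      omega
    · exact fun i => isFewBitProduct_of_mem_forrBuild _ _ _ (List.get_mem _ _)
  rcases Nat.even_or_odd n with hn | hn
  · have he : Even (hadamardCount Q.gates + n + 1) := by
      rw [add_assoc]
      exact ho.add_odd (hn.add_one)
    refine ⟨n + 1, _, (forrBuildPadded Q.gates (WireConfig.init n)).get, by omega, ?_, ?_,
      kForrelationValue_forrBuildPadded Q hQ he⟩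
    · rw [length_forrBuildPadded]
      change 4 * (Q.size + n) + 2 ≤ _
      omega
    · exact fun i => isFewBitProduct_of_mem_forrBuildPadded _ _ _ (List.get_mem _ _)
  · have he : Even (hadamardCount (liftCircuitSucc Q).gates + (n + 1) + 1) := by
      rw [liftCircuitSucc, hadamardCount_liftCircuitSucc, add_assoc]
      exact ho.add_odd (by rw [add_assoc]; exact hn.add_even (by decide))
    refine ⟨n + 1 + 1, _, (forrBuildPadded (liftCircuitSucc Q).gates (WireConfig.init (n + 1))).get, by omega,
      ?_, ?_, ?_⟩
    · rw [length_forrBuildPadded]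
      change 4 * ((liftCircuitSucc Q).size + (n + 1)) + 2 ≤ _
      rw [size_liftCircuitSucc]
      omega
    · exact fun i => isFewBitProduct_of_mem_forrBuildPadded _ _ _ (List.get_mem _ _)
    · rw [kForrelationValue_forrBuildPadded (liftCircuitSucc Q) (isOracleFree_liftCircuitSucc hQ) he,
        transitionAmplitude_liftCircuitSucc]

/-! ### Why `n + 1` bits do not suffice in general -/

/-- The twist is an integer. [folklore] -/
theorem exists_int_cast_eq_twist {m : ℕ} (x y : Fin m → Bool) : ∃ z : ℤ, (z : ℝ) = twist x y := by
  unfold twist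
  refine Finset.prod_induction _ (fun r : ℝ => ∃ z : ℤ, (z : ℝ) = r) ?_ ⟨1, by simp⟩ ?_
  · rintro a b ⟨za, rfl⟩ ⟨zb, rfl⟩
    exact ⟨za * zb, by push_cast; ring⟩
  · intro l _
    split_ifs
    · exact ⟨-1, by simp⟩
    · exact ⟨1, by simp⟩

/-- The path weights of the twisted sum are integers (`±1`). [cite: AaronsonAmbainis2018, §1.1.3] -/
theorem exists_int_cast_eq_pathWeight {m : ℕ} (f : Fin k → (Fin m → Bool) → Bool)
    (x : Fin k → (Fin m → Bool)) : ∃ z : ℤ, (z : ℝ) = pathWeight f x := by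
  unfold pathWeight
  refine Finset.prod_induction _ (fun r : ℝ => ∃ z : ℤ, (z : ℝ) = r) ?_ ⟨1, by simp⟩ ?_
  · rintro a b ⟨za, rfl⟩ ⟨zb, rfl⟩
    exact ⟨za * zb, by push_cast; ring⟩
  · intro i _
    obtain ⟨z1, hz1⟩ : ∃ z : ℤ, (z : ℝ) = signOf (f i (x i)) := by
      unfold signOf
      split_ifs
      · exact ⟨-1, by simp⟩
      · exact ⟨1, by simp⟩
    obtain ⟨z2, hz2⟩ : ∃ z : ℤ, (z : ℝ) =
        (if h : (i : ℕ) = 0 then (1 : ℝ) else twist (x ⟨(i : ℕ) - 1, by omega⟩) (x i)) := by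
      split_ifs
      · exact ⟨1, by simp⟩
      · exact exists_int_cast_eq_twist _ _
    exact ⟨z1 * z2, by push_cast; rw [hz1, hz2]⟩

/-- **Forrelation values on an even number of bits are dyadic rationals**: on `2j` bits,
`Φ_{f₁,…,f_k} = z / 2^{(k+1)j}` with `z ∈ ℤ` (the prefactor `2^{-(k+1)(2j)/2}` is rational and the
twisted sum is an integer). [cite: AaronsonAmbainis2018, §1.1.3 (definition of Φ)] -/
theorem kForrelationValue_two_mul_eq_div (j : ℕ) (f : Fin k → (Fin (2 * j) → Bool) → Bool) :
    ∃ z : ℤ, kForrelationValue f = z / 2 ^ ((k + 1) * j) := by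
  choose z hz using exists_int_cast_eq_pathWeight f
  refine ⟨∑ x, z x, ?_⟩
  rw [kForrelationValue_eq, show (k + 1) * (2 * j) = 2 * ((k + 1) * j) by ring, pow_mul',
    Real.sqrt_sq (by positivity)]
  push_cast
  simp_rw [hz]
  rw [div_eq_inv_mul]

/-- The one-qubit circuit consisting of a single Hadamard gate. [cite: AaronsonAmbainis2018, §6] -/
def singleHCircuit : QCircuit hCCSign 1 := ⟨[hCCSignHOn 0]⟩

/-- `A_H = ⟨0|H|0⟩ = 1/√2`. [cite: NielsenChuang2010, §1.3.1] -/
theorem transitionAmplitude_singleHCircuit : transitionAmplitude singleHCircuit = (Real.sqrt 2)⁻¹ := by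
  apply Complex.ofReal_injective
  rw [transitionAmplitude_coe]
  change (⟨[hCCSignHOn 0]⟩ : QCircuit hCCSign 1).toMatrix 0 _ _ = _
  rw [QCircuit.toMatrix_cons, QCircuit.toMatrix_nil, one_mul, hCCSignHOn, toMatrix_gate_H, placeGate_apply,
    if_pos fun _ _ => rfl, hGate_apply_eq_hadamardEntry]
  simp [hadamardEntry]

/-- **The printed bit count `n + 1` is unattainable in general.** For `n = 1` and `Q = H`
(`A_Q = 1/√2`, irrational) there is no family of Boolean functions on `n + 1 = 2` bits, of any
length and any shape, with `Φ = A_Q`: Forrelation values on `2` bits are dyadic rationals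
(`kForrelationValue_two_mul_eq_div`). Hence the corrected statement uses up to `n + 2` bits.
[cite: AaronsonAmbainis2018, §6 Thm. 25 (proof, p. 27: "f₁,…,f_k : {0,1}^{n+1} → {-1,1}")] -/
theorem not_exists_kForrelationValue_eq_hadamard :
    ¬ ∃ (k : ℕ) (f : Fin k → (Fin 2 → Bool) → Bool), kForrelationValue f = transitionAmplitude singleHCircuit := by
  rintro ⟨k, f, hf⟩
  obtain ⟨z, hz⟩ := kForrelationValue_two_mul_eq_div 1 (k := k) f
  rw [transitionAmplitude_singleHCircuit] at hf
  refine (irrational_sqrt_two.inv).ne_rat (z / 2 ^ ((k + 1) * 1)) ?_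
  rw [← hf, hz]
  push_cast
  ring

end Literature.Computability.QuantumComplexity

end
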